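import Mathlib.Analysis.Complex.BorelCaratheodory
import Mathlib.Topology.Order.Lattice
import Literature.Analysis.Complex.LogDerivZeros
import Literature.Analysis.Complex.VitaliConvergence
import Literature.Analysis.Complex.ExponentialSumDominance
import HarnessLib

/-!
# Zero-free dominated exponential sums: the centre-dominant level dominates the whole disc

Helper file for the crux `TubeZeroFreeChannel` (item `stmt-QuantumFields-18841`, route
`ComplexCouplingChannel` of `QuantumFields/YangMills`), line `FluxPinchSketch`, stub A
(`stub_dominance_of_zeroFree`).  PURE one-variable complex analysis (no gauge theory): the converse
half of the Beraha–Kahane–Weiss mechanism in multi-level form.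

Setting.  On the disc `ball c R` let `Z t` (`t ≥ t₀`) be holomorphic functions approximated by a
dominated exponential sum of `k + 2` holomorphic zero-free levels `lam j` with positive integer
multiplicities `n j`: envelope `Λ = max_j ‖lam j‖` (given through the two envelope hypotheses),
remainder `‖Z t − Σ_j n_j lam_j^t‖ ≤ C (θΛ)^t` with `θ < 1`, no two levels with moduli in a
constant ratio, level `0` strictly dominant at the centre.  IF every `Z t` (`t ≥ t₀`) is zero-free
on the disc THEN level `0` dominates every level on the whole disc (`stub_dominance_of_zeroFree`).

Proof.
* Rates (`Literature.Analysis.Complex.tendsto_log_norm_div_nat`,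
  `Literature/Analysis/Complex/ExponentialSumDominance.lean`): at a point where one level `i` is
  strictly dominant, `t⁻¹ log ‖Z t‖ → log ‖lam i‖ = log Λ`.
* Holomorphic logarithms (`Literature.Analysis.Complex.exists_log_on_ball`): for `t ≥ max t₀ 1`,
  `F_t := t⁻¹ (φ_t + log ‖Z t c‖)` with `Z t = Z t c · exp φ_t`, so `Re F_t = t⁻¹ log ‖Z t‖`,
  `F_t c ∈ ℝ` convergent (rate at the centre), `Re F_t ≤ M` on a smaller disc (crude bound
  `‖Z t‖ ≤ (Σ n_j + C) Λ^t`, `Λ` continuous hence bounded on compacta); Borel–Carathéodory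
  (`Complex.borelCaratheodory`) bounds `‖F_t‖` uniformly on `ball c R₂ ∋ z₁`.
* Montel (`Complex.exists_strictMono_tendstoLocallyUniformlyOn_of_norm_le`,
  `Literature/Analysis/Complex/Montel`): a subsequence converges to a holomorphic `G` on
  `ball c R₂`; by the rates, `Re G = log Λ` wherever one level is strictly dominant, hence on all
  of `ball c R₂` by density (`Literature.Analysis.Complex.exists_mem_forall_norm_lt`, same
  Literature file) and continuity.
* Maximum modulus (`Complex.norm_eqOn_of_isPreconnected_of_isMaxOn`) for
  `H := exp (−G) · lam 0`: `‖H‖ = ‖lam 0‖ / Λ ≤ 1` with equality at the centre, so `‖H‖ ≡ 1`,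
  i.e. `Λ = ‖lam 0‖` on `ball c R₂`.

References: S. Beraha, J. Kahane, N. J. Weiss, *Limits of zeroes of recursively defined families
of polynomials*, Adv. in Math. Suppl. Stud. 1 (1978), 213–232 (the mechanism); A. D. Sokal,
*Chromatic roots are dense in the whole complex plane*, Combin. Probab. Comput. 13 (2004),
221–261, Thm. 3.2.  Everything below is standard and tagged folklore.
-/

set_option autoImplicit false

noncomputable section

open scoped BigOperators Topology
open Filter Metric Set Complex
open Literature.Analysis.Complex (exists_log_on_ball exists_mem_forall_norm_lt
  tendsto_log_norm_div_nat)

namespace Summit.QuantumFields.YangMills.Theorems.TubeZeroFreeChannel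

/-! ### The stub -/

/-- **STUB A `stub_dominance_of_zeroFree` (line `FluxPinchSketch` of crux `TubeZeroFreeChannel`):
zero-freeness of a dominated exponential sum forces global dominance of the centre-dominant
level.**  On `ball c R` let `Z t` (`t ≥ t₀`) be holomorphic with
`‖Z t − Σ_j n_j (lam j)^t‖ ≤ C (θ Λ)^t` (`0 ≤ θ < 1`, `n_j ≥ 1`), the `k + 2` levels `lam j`
holomorphic and zero-free with envelope `Λ` (`‖lam j‖ ≤ Λ`, attained), no two levels with moduli
in a constant ratio on the disc, and level `0` strictly dominant at `c`.  If every `Z t`, `t ≥ t₀`,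
is zero-free on `ball c R`, then `‖lam j z‖ ≤ ‖lam 0 z‖` for all `j` and all `z ∈ ball c R`.
Proof: normalised holomorphic logarithms `F_t = t⁻¹ log Z t` (Borel–Carathéodory bound), a Montel
subsequence limit `G` with `Re G = log Λ` on the dense set where one level strictly dominates
(`tendsto_log_norm_div_nat`, `exists_mem_forall_norm_lt`), hence everywhere; then
`‖exp (−G) · lam 0‖ = ‖lam 0‖ / Λ ≤ 1` attains its maximum `1` at the centre, so it is `≡ 1`
(maximum modulus principle). [folklore] -/
theorem stub_dominance_of_zeroFree :
    ∀ (Z : ℕ → ℂ → ℂ) (c : ℂ) (R : ℝ) (k : ℕ) (lam : Fin (k + 2) → ℂ → ℂ) (n : Fin (k + 2) → ℕ)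
      (Λ : ℂ → ℝ) (C θ : ℝ) (t₀ : ℕ),
      0 < R → (∀ j, 0 < n j) → 0 ≤ C → 0 ≤ θ → θ < 1 →
      (∀ t, t₀ ≤ t → DifferentiableOn ℂ (Z t) (ball c R)) →
      (∀ j, DifferentiableOn ℂ (lam j) (ball c R)) →
      (∀ j, ∀ z ∈ ball c R, lam j z ≠ 0 ∧ ‖lam j z‖ ≤ Λ z) →
      (∀ z ∈ ball c R, ∃ j, ‖lam j z‖ = Λ z) →
      (∀ i j, i ≠ j → ¬ ∃ a : ℝ, ∀ z ∈ ball c R, ‖lam i z‖ = a * ‖lam j z‖) →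
      (∀ z ∈ ball c R, ∀ t : ℕ, t₀ ≤ t →
        ‖Z t z - ∑ j, (n j : ℂ) * (lam j z) ^ t‖ ≤ C * (θ * Λ z) ^ t) →
      (∀ j, j ≠ 0 → ‖lam j c‖ < ‖lam 0 c‖) →
      (∀ t, t₀ ≤ t → ∀ z ∈ ball c R, Z t z ≠ 0) →
      ∀ j, ∀ z ∈ ball c R, ‖lam j z‖ ≤ ‖lam 0 z‖ := by
  intro Z c R k lam n Λ C θ t₀ hR hn hC hθ hθ1 hZd hlamd hlam henv hnd hdom htop hzf j z₁ hz₁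
  /- (a) envelope facts -/
  have hΛpos : ∀ z ∈ ball c R, 0 < Λ z := fun z hz =>
    lt_of_lt_of_le (norm_pos_iff.2 (hlam 0 z hz).1) (hlam 0 z hz).2
  have hΛtop : ∀ z ∈ ball c R, ∀ i, (∀ i', i' ≠ i → ‖lam i' z‖ < ‖lam i z‖) →
      Λ z = ‖lam i z‖ := by
    intro z hz i hi
    obtain ⟨j', hj'⟩ := henv z hz
    refine le_antisymm ?_ (hlam i z hz).2
    rw [← hj']
    by_cases h : j' = i
    · rw [h]
    · exact (hi j' h).le
  have hcR : c ∈ ball c R := mem_ball_self hR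
  have hΛc : Λ c = ‖lam 0 c‖ := hΛtop c hcR 0 htop
  /- radii `dist z₁ c < R₂ < R₁ < R` -/
  have hd₁ : dist z₁ c < R := mem_ball.1 hz₁
  have hd₀ : 0 ≤ dist z₁ c := dist_nonneg
  set R₂ : ℝ := (dist z₁ c + R) / 2 with hR₂
  set R₁ : ℝ := (R₂ + R) / 2 with hR₁
  have hR₂pos : 0 < R₂ := by rw [hR₂]; linarith
  have hz₁R₂ : z₁ ∈ ball c R₂ := mem_ball.2 (by rw [hR₂]; linarith)
  have hR₂R : R₂ < R := by rw [hR₂]; linarith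
  have hR₂₁ : R₂ < R₁ := by rw [hR₁]; linarith
  have hR₁R : R₁ < R := by rw [hR₁]; linarith
  have hR₁pos : 0 < R₁ := lt_trans hR₂pos hR₂₁
  have hsub₁ : ball c R₁ ⊆ ball c R := ball_subset_ball hR₁R.le
  have hsub₂ : ball c R₂ ⊆ ball c R := ball_subset_ball hR₂R.le
  /- (b) continuity of `Λ` on the disc and a bound on `ball c R₁` -/
  have hΛcont : ContinuousOn Λ (ball c R) := by
    have h : ContinuousOn (fun z => Finset.univ.sup' Finset.univ_nonempty (fun j => ‖lam j z‖))
        (ball c R) :=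
      ContinuousOn.finset_sup'_apply Finset.univ_nonempty fun j _ => (hlamd j).continuousOn.norm
    refine h.congr fun z hz => ?_
    refine le_antisymm ?_ (Finset.sup'_le _ _ fun j _ => (hlam j z hz).2)
    obtain ⟨j', hj'⟩ := henv z hz
    rw [← hj']
    exact Finset.le_sup' (fun j => ‖lam j z‖) (Finset.mem_univ j')
  obtain ⟨B₀, hB₀⟩ := (isCompact_closedBall c R₁).exists_bound_of_continuousOn
    (hΛcont.mono (closedBall_subset_ball hR₁R))
  set B : ℝ := max B₀ 1 with hB
  have hB1 : 1 ≤ B := le_max_right _ _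
  have hΛB : ∀ z ∈ ball c R₁, Λ z ≤ B := by
    intro z hz
    have h := hB₀ z (ball_subset_closedBall hz)
    rw [Real.norm_eq_abs] at h
    exact le_trans (le_trans (le_abs_self _) h) (le_max_left _ _)
  /- (c) the crude bound `‖Z t z‖ ≤ (N + C) Λ z ^ t` -/
  set N : ℝ := ∑ j, (n j : ℝ) with hN
  have hN1 : 1 ≤ N := by
    calc (1 : ℝ) ≤ n 0 := by exact_mod_cast hn 0
      _ ≤ N := Finset.single_le_sum (f := fun j => (n j : ℝ)) (fun j _ => Nat.cast_nonneg _)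
          (Finset.mem_univ 0)
  have hZle : ∀ z ∈ ball c R, ∀ t : ℕ, t₀ ≤ t → ‖Z t z‖ ≤ (N + C) * Λ z ^ t := by
    intro z hz t ht
    have hΛ0 : 0 ≤ Λ z := (hΛpos z hz).le
    have h1 : ‖∑ j, (n j : ℂ) * lam j z ^ t‖ ≤ N * Λ z ^ t := by
      calc ‖∑ j, (n j : ℂ) * lam j z ^ t‖ ≤ ∑ j, ‖(n j : ℂ) * lam j z ^ t‖ := norm_sum_le _ _
        _ ≤ ∑ j, (n j : ℝ) * Λ z ^ t := Finset.sum_le_sum fun j _ => by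
            rw [norm_mul, norm_pow, Complex.norm_natCast]
            exact mul_le_mul_of_nonneg_left (pow_le_pow_left₀ (norm_nonneg _) (hlam j z hz).2 t)
              (Nat.cast_nonneg _)
        _ = N * Λ z ^ t := by rw [hN, Finset.sum_mul]
    have h2 : C * (θ * Λ z) ^ t ≤ C * Λ z ^ t := by
      refine mul_le_mul_of_nonneg_left ?_ hC
      rw [mul_pow]
      exact mul_le_of_le_one_left (pow_nonneg hΛ0 _) (pow_le_one₀ hθ hθ1.le)
    calc ‖Z t z‖ = ‖(Z t z - ∑ j, (n j : ℂ) * lam j z ^ t) + ∑ j, (n j : ℂ) * lam j z ^ t‖ := by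
          rw [sub_add_cancel]
      _ ≤ ‖Z t z - ∑ j, (n j : ℂ) * lam j z ^ t‖ + ‖∑ j, (n j : ℂ) * lam j z ^ t‖ :=
          norm_add_le _ _
      _ ≤ C * (θ * Λ z) ^ t + N * Λ z ^ t := add_le_add (hdom z hz t ht) h1
      _ ≤ C * Λ z ^ t + N * Λ z ^ t := by linarith
      _ = (N + C) * Λ z ^ t := by ring
  /- (d) the normalised holomorphic logarithms `F t`, `t ≥ T := max t₀ 1` -/
  set T : ℕ := max t₀ 1 with hT
  have hTt₀ : t₀ ≤ T := le_max_left _ _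
  have hT1 : 1 ≤ T := le_max_right _ _
  have hlog : ∀ t : ℕ, ∃ φ : ℂ → ℂ, T ≤ t → (DifferentiableOn ℂ φ (ball c R) ∧ φ c = 0 ∧
      ∀ z ∈ ball c R, Z t z = Z t c * exp (φ z)) := by
    intro t
    by_cases ht : T ≤ t
    · obtain ⟨φ, hφd, hφc, -, hφe⟩ :=
        exists_log_on_ball (hZd t (hTt₀.trans ht)) (hzf t (hTt₀.trans ht))
      exact ⟨φ, fun _ => ⟨hφd, hφc, hφe⟩⟩
    · exact ⟨fun _ => 0, fun h => absurd h ht⟩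
  choose φ hφ using hlog
  obtain ⟨F, hFd, hFre, hFc⟩ : ∃ F : ℕ → ℂ → ℂ,
      (∀ t, T ≤ t → DifferentiableOn ℂ (F t) (ball c R)) ∧
      (∀ t, T ≤ t → ∀ z ∈ ball c R, (F t z).re = Real.log ‖Z t z‖ / t) ∧
      (∀ t, T ≤ t → F t c = ((Real.log ‖Z t c‖ / t : ℝ) : ℂ)) := by
    refine ⟨fun t z => (φ t z + (Real.log ‖Z t c‖ : ℂ)) / (t : ℂ), fun t ht => ?_,
      fun t ht z hz => ?_, fun t ht => ?_⟩
    · exact ((hφ t ht).1.add_const _).div_const _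
    · obtain ⟨-, -, hφe⟩ := hφ t ht
      have hZc : Z t c ≠ 0 := hzf t (hTt₀.trans ht) c hcR
      have h1 : ‖Z t z‖ = ‖Z t c‖ * Real.exp (φ t z).re := by
        rw [hφe z hz, norm_mul, Complex.norm_exp]
      have h2 : Real.log ‖Z t z‖ = Real.log ‖Z t c‖ + (φ t z).re := by
        rw [h1, Real.log_mul (norm_ne_zero_iff.2 hZc) (Real.exp_pos _).ne', Real.log_exp]
      simp only [Complex.div_natCast_re, Complex.add_re, Complex.ofReal_re]
      rw [h2, add_comm]
    · simp only [(hφ t ht).2.1, zero_add, Complex.ofReal_div, Complex.ofReal_natCast]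
  /- (e) rates at points with a strictly dominant level -/
  have hrate : ∀ z ∈ ball c R, ∀ i, (∀ i', i' ≠ i → ‖lam i' z‖ < ‖lam i z‖) →
      Tendsto (fun t : ℕ => Real.log ‖Z t z‖ / t) atTop (𝓝 (Real.log (Λ z))) := by
    intro z hz i hi
    rw [hΛtop z hz i hi]
    exact tendsto_log_norm_div_nat (Zt := fun t => Z t z) (lamz := fun j => lam j z) hn hθ hθ1
      (hΛtop z hz i hi) hi (fun t ht => hdom z hz t ht) (fun t ht => hzf t ht z hz) (hlam i z hz).1
  /- (f) `F t c` is a bounded real sequence -/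
  obtain ⟨A, hA⟩ : ∃ A : ℝ, ∀ t, T ≤ t → ‖F t c‖ ≤ A := by
    obtain ⟨A, hA⟩ := ((hrate c hcR 0 htop).norm).bddAbove_range
    refine ⟨A, fun t ht => ?_⟩
    rw [hFc t ht, Complex.norm_real]
    exact hA (Set.mem_range_self t)
  have hA0 : 0 ≤ A := le_trans (norm_nonneg _) (hA T le_rfl)
  /- (g) `Re F t ≤ M` on `ball c R₁` -/
  set M : ℝ := Real.log (N + C) + Real.log B + 1 with hM
  have hlogNC : 0 ≤ Real.log (N + C) := Real.log_nonneg (by linarith)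
  have hlogB : 0 ≤ Real.log B := Real.log_nonneg hB1
  have hM0 : 0 < M := by rw [hM]; linarith
  have hFreM : ∀ t, T ≤ t → ∀ z ∈ ball c R₁, (F t z).re ≤ M := by
    intro t ht z hz
    have hzR : z ∈ ball c R := hsub₁ hz
    have ht1 : (1 : ℝ) ≤ t := by exact_mod_cast hT1.trans ht
    have ht0 : (0 : ℝ) < t := by linarith
    have hZpos : 0 < ‖Z t z‖ := norm_pos_iff.2 (hzf t (hTt₀.trans ht) z hzR)
    have h1 : ‖Z t z‖ ≤ (N + C) * B ^ t := (hZle z hzR t (hTt₀.trans ht)).trans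
      (mul_le_mul_of_nonneg_left (pow_le_pow_left₀ (hΛpos z hzR).le (hΛB z hz) t) (by linarith))
    have h2 : Real.log ‖Z t z‖ ≤ Real.log (N + C) + t * Real.log B := by
      rw [← Real.log_pow, ← Real.log_mul (by linarith) (pow_pos (by linarith) _).ne']
      exact Real.log_le_log hZpos h1
    rw [hFre t ht z hzR, div_le_iff₀ ht0, hM]
    nlinarith
  /- (h) Borel–Carathéodory: `‖F t‖ ≤ Bd` on `ball c R₂` -/
  set Bd : ℝ := 2 * M * R₂ / (R₁ - R₂) + A * (R₁ + R₂) / (R₁ - R₂) with hBd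
  have hFbd : ∀ t, T ≤ t → ∀ z ∈ ball c R₂, ‖F t z‖ ≤ Bd := by
    intro t ht z hz
    set f : ℂ → ℂ := fun w => F t (c + w) with hf
    have hmaps : ∀ w ∈ ball (0 : ℂ) R₁, c + w ∈ ball c R₁ := fun w hw => by
      simpa [mem_ball, dist_eq_norm] using hw
    have hfd : DifferentiableOn ℂ f (ball 0 R₁) :=
      ((hFd t ht).mono hsub₁).comp ((differentiable_id.const_add _).differentiableOn)
        fun w hw => hmaps w hw
    have hfre : MapsTo f (ball 0 R₁) {z | z.re ≤ M} := fun w hw => hFreM t ht _ (hmaps w hw)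
    have hw : z - c ∈ ball (0 : ℂ) R₁ := by
      have : dist z c < R₁ := lt_trans (mem_ball.1 hz) hR₂₁
      simpa [mem_ball, dist_eq_norm] using this
    have key := Complex.borelCaratheodory hM0 hfd hfre hR₁pos hw
    have hfz : f (z - c) = F t z := by simp [hf]
    have hf0 : f 0 = F t c := by simp [hf]
    rw [hfz, hf0] at key
    have hzc : ‖z - c‖ < R₂ := by rw [← dist_eq_norm]; exact mem_ball.1 hz
    have hzc0 : 0 ≤ ‖z - c‖ := norm_nonneg _
    refine key.trans (add_le_add ?_ ?_)
    · exact div_le_div₀ (by positivity) (by nlinarith) (by linarith) (by linarith)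
    · exact div_le_div₀ (by positivity)
        (mul_le_mul (hA t ht) (by linarith) (by positivity) hA0) (by linarith) (by linarith)
  /- (i) Montel on `ball c R₂` for `s ↦ F (s + T)` -/
  obtain ⟨G, ψ, hψ, hGd, hlim, -⟩ :=
    Complex.exists_strictMono_tendstoLocallyUniformlyOn_of_norm_le isOpen_ball
      (fun s => (hFd (s + T) (Nat.le_add_left _ _)).mono hsub₂)
      (fun s z hz => hFbd (s + T) (Nat.le_add_left _ _) z hz)
  /- (j) `Re G = log Λ` at the points of `ball c R₂` with a strictly dominant level -/
  have hGre_top : ∀ z ∈ ball c R₂, ∀ i, (∀ i', i' ≠ i → ‖lam i' z‖ < ‖lam i z‖) →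
      (G z).re = Real.log (Λ z) := by
    intro z hz i hi
    have h1 : Tendsto (fun s => (F (ψ s + T) z).re) atTop (𝓝 (G z).re) :=
      (Complex.continuous_re.tendsto _).comp (hlim.tendsto_at hz)
    have h2 : Tendsto (fun s => Real.log ‖Z (ψ s + T) z‖ / ((ψ s + T : ℕ) : ℝ)) atTop
        (𝓝 (Real.log (Λ z))) :=
      ((tendsto_add_atTop_iff_nat T).2 (hrate z (hsub₂ hz) i hi)).comp hψ.tendsto_atTop
    have h3 : (fun s => (F (ψ s + T) z).re) =
        fun s => Real.log ‖Z (ψ s + T) z‖ / ((ψ s + T : ℕ) : ℝ) := by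
      funext s
      exact hFre _ (Nat.le_add_left _ _) z (hsub₂ hz)
    rw [h3] at h1
    exact tendsto_nhds_unique h1 h2
  /- (k) density: `Re G = log Λ` on all of `ball c R₂` -/
  have hGre : ∀ z ∈ ball c R₂, (G z).re = Real.log (Λ z) := by
    intro z hz
    by_contra hne
    have hcont : ContinuousOn (fun w => (G w).re - Real.log (Λ w)) (ball c R₂) :=
      (Complex.continuous_re.comp_continuousOn hGd.continuousOn).sub
        ((hΛcont.mono hsub₂).log fun w hw => (hΛpos w (hsub₂ hw)).ne')
    have hWo : IsOpen (ball c R₂ ∩ (fun w => (G w).re - Real.log (Λ w)) ⁻¹' {0}ᶜ) :=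
      hcont.isOpen_inter_preimage isOpen_ball isOpen_compl_singleton
    have hzW : z ∈ ball c R₂ ∩ (fun w => (G w).re - Real.log (Λ w)) ⁻¹' {0}ᶜ :=
      ⟨hz, fun h => hne (sub_eq_zero.1 h)⟩
    obtain ⟨w, hwW, i, hi⟩ := exists_mem_forall_norm_lt hlamd hlam henv hnd hWo
      (fun w hw => hsub₂ hw.1) hzW
    exact hwW.2 (sub_eq_zero.2 (hGre_top w hwW.1 i hi))
  /- (l) maximum modulus for `H := exp (-G) * lam 0` on `ball c R₂` -/
  set H : ℂ → ℂ := fun z => exp (-G z) * lam 0 z with hH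
  have hHd : DifferentiableOn ℂ H (ball c R₂) := hGd.neg.cexp.mul ((hlamd 0).mono hsub₂)
  have hHn : ∀ z ∈ ball c R₂, ‖H z‖ = ‖lam 0 z‖ / Λ z := by
    intro z hz
    simp only [hH, norm_mul, Complex.norm_exp, Complex.neg_re, hGre z hz, Real.exp_neg,
      Real.exp_log (hΛpos z (hsub₂ hz))]
    rw [inv_mul_eq_div]
  have hcR₂ : c ∈ ball c R₂ := mem_ball_self hR₂pos
  have hHc : ‖H c‖ = 1 := by
    rw [hHn c hcR₂, hΛc, div_self (norm_ne_zero_iff.2 (hlam 0 c hcR).1)]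
  have hmax : IsMaxOn (norm ∘ H) (ball c R₂) c := fun z hz => by
    simp only [Function.comp_apply, mem_setOf_eq]
    rw [hHc, hHn z hz, div_le_one (hΛpos z (hsub₂ hz))]
    exact (hlam 0 z (hsub₂ hz)).2
  have hconst := Complex.norm_eqOn_of_isPreconnected_of_isMaxOn (convex_ball c R₂).isPreconnected
    isOpen_ball hHd hcR₂ hmax
  have hfin : Λ z₁ = ‖lam 0 z₁‖ := by
    have h1 : ‖H z₁‖ = ‖H c‖ := hconst hz₁R₂
    rw [hHc, hHn z₁ hz₁R₂, div_eq_one_iff_eq (hΛpos z₁ hz₁).ne'] at h1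
    exact h1.symm
  calc ‖lam j z₁‖ ≤ Λ z₁ := (hlam j z₁ hz₁).2
    _ = ‖lam 0 z₁‖ := hfin

end Summit.QuantumFields.YangMills.Theorems.TubeZeroFreeChannel
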